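import Literature.Probability.Percolation.KozmaNitzanGoodQuadruple
import HarnessLib

/-!
# Kozma–Nitzan Conjecture 1 on APEX-FOREST graphs — graph lemmas for the semantic bridge
# (`NoHeavyLowerTail` cell, stmt-CriticalPhenomena-4575; new-inequality factory seat `prim-ineq-gen-7`, gen 3)

Support file (`--supports stmt-CriticalPhenomena-4575`).  Deterministic lemmas about open paths in a bond configuration; no measure theory,
no definitions, no named facts, no sorries.  They are the two walk-surgery facts used by the forest induction of
"KN Conjecture 1 whenever `G − b` is a forest" (paper proof run/shared/lean/prim/prim-ineq-gen-7/PROOF-CONJ1-APEXFOREST.md; algebraic step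
`ApexForestAlgebra.step`, recursion-level induction `ApexForestRec.gluing_le`; plan LEAN-PLAN-APEXFOREST.md):

* `ApexForestWalks.pathIn_of_walk_support` — an open walk whose support lies in `S` is an open path in `S` (`openConnIn`).
* `ApexForestWalks.openConn_hub_iff` — **FACT 1** ("last edge"): `x ↔ c` iff some `u ≠ c` is joined to `x` OFF `c` and the pair `s(u,c)` is open:
  `ω ∈ openConn x c ↔ ∃ u ≠ c, ω ∈ openConnIn {c}ᶜ x u ∧ s(u,c) ∈ ω` (`x ≠ c`).  Hence `{x ↮ c}` = "the hub pairs of the off-`c` cluster of `x` are closed".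
* `ApexForestWalks.reachable_insert_iff` — **adding one pair** `e = s(x,y)`: `u ↔ v` in `insert e ω` iff `u ↔ v`, or `u ↔ x ∧ y ↔ v`, or `u ↔ y ∧ x ↔ v` in `ω`
  (the bridge split of a cluster across a forest edge is the case where the last two options are the only new ones).
[cite: Grimmett1999, §1.3 (open paths and clusters)]
-/

namespace Summit.CriticalPhenomena.PercolationContinuityZ3.Theorems

namespace ApexForestWalks

open Literature.Probability.Percolation

variable {V : Type*}

/-- An open walk all of whose vertices lie in `S` gives `ω ∈ openConnIn S u v`. [folklore] -/
theorem pathIn_of_walk_support {ω : BondConfig V} {S : Set V} :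
    ∀ {u v : V} (p : (openGraph ω).Walk u v), (∀ z ∈ p.support, z ∈ S) → ω ∈ openConnIn S u v
  | _, _, .nil, hS => by
      refine DCT16.mem_openConnIn_of_pathIn (PathIn.refl ?_)
      exact hS _ (by simp)
  | u, v, .cons (v := u') hadj q, hS => by
      have hu : u ∈ S := hS u (by simp)
      have hq : ∀ z ∈ q.support, z ∈ S := fun z hz => hS z (by simp [hz])
      have ih := pathIn_of_walk_support q hq
      have hpath := DCT16.pathIn_of_mem_openConnIn ih
      refine DCT16.mem_openConnIn_of_pathIn ⟨hu, ?_⟩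
      exact Relation.ReflTransGen.head ⟨hadj, hpath.1⟩ hpath.2

/-- **FACT 1 (last edge to the hub).**  For `x ≠ c`: `x ↔ c` iff some vertex `u ≠ c` is joined to `x` by an open path avoiding `c`
and the pair `s(u, c)` is open.  (Take an open PATH from `c` to `x`; its first step leaves `c` along an open pair `s(c,u)` and, the
path having no repeated vertex, never returns to `c`.) [folklore] -/
theorem openConn_hub_iff [DecidableEq V] (ω : BondConfig V) {x c : V} (hxc : x ≠ c) :
    ω ∈ (openConn x c : Set (BondConfig V)) ↔
      ∃ u, u ≠ c ∧ ω ∈ openConnIn ({c}ᶜ : Set V) x u ∧ s(u, c) ∈ ω := by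
  constructor
  · intro h
    have hcx : (openGraph ω).Reachable c x := SimpleGraph.Reachable.symm h
    obtain ⟨p, hp⟩ : ∃ p : (openGraph ω).Walk c x, p.IsPath := by
      obtain ⟨w⟩ := hcx
      exact ⟨w.bypass, w.bypass_isPath⟩
    cases p with
    | nil => exact absurd rfl hxc
    | cons hadj q =>
      rename_i u
      have hcu : s(c, u) ∈ ω ∧ c ≠ u := (openGraph_adj ω c u).1 hadj
      have hnodup := hp.support_nodup
      rw [SimpleGraph.Walk.support_cons, List.nodup_cons] at hnodup
      have hcq : c ∉ q.support := hnodup.1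
      refine ⟨u, fun h => hcu.2 h.symm, ?_, by rw [Sym2.eq_swap]; exact hcu.1⟩
      -- the walk `q.reverse : x ⇝ u` avoids `c`
      have hsupp : ∀ z ∈ q.reverse.support, z ∈ ({c}ᶜ : Set V) := by
        intro z hz
        rw [SimpleGraph.Walk.support_reverse, List.mem_reverse] at hz
        intro hzc
        rw [Set.mem_singleton_iff] at hzc
        subst hzc
        exact hcq hz
      exact pathIn_of_walk_support q.reverse hsupp
  · rintro ⟨u, huc, hxu, huc'⟩
    have h1 : (openGraph ω).Reachable x u := KNPreFKG.reachable_of_openConnIn hxu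
    have h2 : (openGraph ω).Adj u c := (openGraph_adj ω u c).2 ⟨huc', huc⟩
    exact h1.trans h2.reachable

/-- **Adding one open pair.**  For `e = s(x, y)` with `x ≠ y`: `u` and `v` are joined in `insert e ω` iff they are joined in `ω`, or `u ↔ x`
and `y ↔ v` in `ω`, or `u ↔ y` and `x ↔ v` in `ω`. [folklore] -/
theorem reachable_insert_iff (ω : BondConfig V) {x y : V} (hxy : x ≠ y) (u v : V) :
    (openGraph (insert s(x, y) ω)).Reachable u v ↔
      (openGraph ω).Reachable u v ∨
        ((openGraph ω).Reachable u x ∧ (openGraph ω).Reachable y v) ∨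
        ((openGraph ω).Reachable u y ∧ (openGraph ω).Reachable x v) := by
  have hmono : openGraph ω ≤ openGraph (insert s(x, y) ω) := by
    intro a b hab
    rw [openGraph_adj] at hab ⊢
    exact ⟨Set.mem_insert_of_mem _ hab.1, hab.2⟩
  have hxy' : (openGraph (insert s(x, y) ω)).Reachable x y :=
    SimpleGraph.Adj.reachable ((openGraph_adj _ x y).2 ⟨Set.mem_insert _ _, hxy⟩)
  -- induction on a walk in the larger configuration
  have key : ∀ {a : V} (p : (openGraph (insert s(x, y) ω)).Walk a v),
      (openGraph ω).Reachable a v ∨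
        ((openGraph ω).Reachable a x ∧ (openGraph ω).Reachable y v) ∨
        ((openGraph ω).Reachable a y ∧ (openGraph ω).Reachable x v) := by
    intro a p
    induction p with
    | nil => exact Or.inl (SimpleGraph.Reachable.refl _)
    | cons hadj q ih =>
      rename_i a b _
      have hab : s(a, b) ∈ insert s(x, y) ω ∧ a ≠ b := (openGraph_adj _ a b).1 hadj
      rcases Set.mem_insert_iff.1 hab.1 with heq | hmem
      · -- the step uses the new pair: {a, b} = {x, y}
        rcases Sym2.eq_iff.1 heq with ⟨rfl, rfl⟩ | ⟨rfl, rfl⟩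
        · -- a = x, b = y
          rcases ih with h | ⟨h1, h2⟩ | ⟨h1, h2⟩
          · exact Or.inr (Or.inl ⟨SimpleGraph.Reachable.refl _, h⟩)
          · exact Or.inr (Or.inl ⟨SimpleGraph.Reachable.refl _, h2⟩)
          · exact Or.inl h2
        · -- a = y, b = x
          rcases ih with h | ⟨h1, h2⟩ | ⟨h1, h2⟩
          · exact Or.inr (Or.inr ⟨SimpleGraph.Reachable.refl _, h⟩)
          · exact Or.inl h2
          · exact Or.inr (Or.inr ⟨SimpleGraph.Reachable.refl _, h2⟩)
      · have hab' : (openGraph ω).Reachable a b :=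
          SimpleGraph.Adj.reachable ((openGraph_adj ω a b).2 ⟨hmem, hab.2⟩)
        rcases ih with h | ⟨h1, h2⟩ | ⟨h1, h2⟩
        · exact Or.inl (hab'.trans h)
        · exact Or.inr (Or.inl ⟨hab'.trans h1, h2⟩)
        · exact Or.inr (Or.inr ⟨hab'.trans h1, h2⟩)
  constructor
  · rintro ⟨p⟩
    exact key p
  · rintro (h | ⟨h1, h2⟩ | ⟨h1, h2⟩)
    · exact h.mono hmono
    · exact ((h1.mono hmono).trans hxy').trans (h2.mono hmono)
    · exact ((h1.mono hmono).trans hxy'.symm).trans (h2.mono hmono)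

end ApexForestWalks

end Summit.CriticalPhenomena.PercolationContinuityZ3.Theorems
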